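import Summits.NavierStokesRegularity.NavierStokesRegularity.Theorems.GaldiLiouvilleGateRecordZoomAncientStubFastBranch
import Summits.NavierStokesRegularity.NavierStokesRegularity.Theorems.GaldiLiouvilleGateRecordZoomAncientStubTaoRep
import Literature.Analysis.FluidPDE.ConstantinDirectionDissipationProofs
import HarnessLib

/-!
# Route `GaldiLiouvilleGate`, crux `RecordZoomAncient` (stmt-NavierStokesRegularity-0894),
  line `registered` (r7) — the FAINTNESS FLOOR: enstrophy is slaved to the velocity maximum

**Statement (`enstrophy_le_kineticEnergy_mul_velocitySq`).** For a classical solution `(u, p)` of the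
unforced Navier–Stokes system (viscosity `ν > 0`) on `ℝ³ × [0, T)`, Leray–Hopf from the rapidly decaying
`u 0`, a time `t ∈ [0, T)` and a level `M > 0` dominating the velocity on `[0, t] × ℝ³` with `t ≥ ν/M²`
(one viscous time unit):
`∫ |∇u(t)|² ≤ e^{1/2} · E₀ · M²/ν²`, `E₀ = ½‖u(0)‖₂²` (`VectorCalculus.kineticEnergy (u 0)`).

So the enstrophy can exceed `ν M̄(t)` — the blow-up can be FAINT in the sense of the kernel of this line
(`Cruxes/RecordZoomAncient/KERNEL.md`: local Reynolds number `Re(t) = sup_{[0,t]} ∫|∇u|²/(ν M̄(t)) → ∞`) — by at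
most the factor `e^{1/2} E₀ M̄(t)/ν³`: `Re(t) ≤ e^{1/2} E₀ M̄(t)/ν³`, equivalently `M̄(t) ≥ e^{-1/4} ν (Ē(t)/E₀)^{1/2}`
(the velocity maximum dominates the square root of the enstrophy record). This is the only a-priori
constraint on faintness known to the line (leads c2–c4); it is recorded here as a theorem.

**Proof.** Energy inequality of the classical Leray–Hopf solution through the classical gradient
(`IsLerayHopfOn.lintegral_frobeniusNormSq_fderiv_of_classical`: `ν ∫₀ᵀ ∫|∇u|² ≤ E₀`): on the window
`(t − ν/M², t)` of length `τ = ν/M²` some time `s` has `∫|∇u(s)|² ≤ B` for every `B > E₀/(ντ) = E₀M²/ν²`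
(otherwise the dissipation over the window alone exceeds `E₀/ν`). Serrin's endpoint enstrophy inequality on
the restarted Tao-class slab `[0, t − s]` (`stub_taoRep`, `IsTaoSolutionOn.translate/.mono`,
`lintegral_frobeniusNormSq_fderiv_le_mul_exp` with the bound `‖u‖ ≤ M`):
`∫|∇u(t)|² ≤ exp(M²(t − s)/(2ν)) ∫|∇u(s)|² ≤ e^{1/2} B`; let `B ↓ E₀M²/ν²`.

Sources: J. Leray, Acta Math. 63 (1934) §§19–20 (energy inequality, enstrophy growth); J. Serrin, in
*Nonlinear Problems* (1963) §4; P. Constantin, Comm. Math. Phys. 129 (1990) (2.21).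
-/

noncomputable section

open Set MeasureTheory Filter Topology Function
open scoped ENNReal NNReal
open Literature.Analysis.FluidPDE

namespace Summit.NavierStokesRegularity.NavierStokesRegularity.Theorems.RecordZoomAncient.Birth

-- the problem-side namespace `Summit.NavierStokesRegularity.NavierStokesRegularity.…` (summit =
-- problem for this single-problem summit) duplicates `NavierStokesRegularity` by design
set_option linter.dupNamespace false

/-- **The faintness floor: enstrophy is slaved to the velocity maximum after one viscous time unit.**
For a classical solution `(u, p)` on `ℝ³ × [0, T)`, Leray–Hopf from the rapidly decaying `u 0`, a time
`t ∈ [0, T)`, and `M > 0` with `‖u(s, x)‖ ≤ M` on `[0, t] × ℝ³` and `ν/M² ≤ t`: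
`∫ |∇u(t)|² ≤ e^{1/2} · kineticEnergy (u 0) · M²/ν²`. (Energy inequality on the window
`(t − ν/M², t)` + Serrin's endpoint enstrophy inequality on the restarted Tao-class slab; module docstring.) -/
theorem enstrophy_le_kineticEnergy_mul_velocitySq :
    ∀ (ν T : ℝ), 0 < ν → 0 < T →
      ∀ (u : ℝ → EuclideanSpace ℝ (Fin 3) → EuclideanSpace ℝ (Fin 3)) (p : ℝ → EuclideanSpace ℝ (Fin 3) → ℝ),
        IsClassicalNSSolutionOn (Set.Ico 0 T) ν 0 u p → IsLerayHopfOn T ν 0 (u 0) u →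
        HasRapidSpatialDecay (u 0) →
        ∀ t ∈ Set.Ico 0 T, ∀ M : ℝ, 0 < M → ν / M ^ 2 ≤ t →
          (∀ s ∈ Set.Icc 0 t, ∀ x, ‖u s x‖ ≤ M) →
          ∫⁻ x, ENNReal.ofReal (frobeniusNormSq (fderiv ℝ (u t) x)) ≤
            ENNReal.ofReal (Real.exp (1 / 2) * VectorCalculus.kineticEnergy (u 0) * M ^ 2 / ν ^ 2) := by
  intro ν T hν hT u p hcl hLH hdec t ht M hM hτt hdom
  -- notation
  set E : ℝ → ℝ≥0∞ := fun s => ∫⁻ x, ENNReal.ofReal (frobeniusNormSq (fderiv ℝ (u s) x)) with hE_def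
  set τ : ℝ := ν / M ^ 2 with hτ_def
  have hτ : 0 < τ := div_pos hν (pow_pos hM 2)
  set E₀ : ℝ := VectorCalculus.kineticEnergy (u 0) with hE₀_def
  have hE₀ : 0 ≤ E₀ := kineticEnergy_nonneg _
  -- the Tao representation on every `[0, T']`, `T' < T`
  have hrep : ∀ T' ∈ Set.Ioo 0 T, ∃ P : ℝ → EuclideanSpace ℝ (Fin 3) → ℝ, IsTaoSolutionOn T' ν (u 0) u P :=
    stub_taoRep ν T hν hT u p hcl hLH hdec
  -- ### Step 1: the dissipation over the window `(t - τ, t)` is at most `E₀/ν`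
  obtain ⟨hfin, hdiss⟩ := hLH.lintegral_frobeniusNormSq_fderiv_of_classical hcl hT
  have hwin_sub : Set.Ioo (t - τ) t ⊆ Set.Ioo 0 T := fun s hs =>
    ⟨by linarith [hs.1], hs.2.trans ht.2⟩
  have hwin : (∫⁻ s in Set.Ioo (t - τ) t, E s) ≤ ENNReal.ofReal (E₀ / ν) := by
    have h1 : (∫⁻ s in Set.Ioo (t - τ) t, E s) ≤ ∫⁻ s in Set.Ioo 0 T, E s :=
      lintegral_mono_set hwin_sub
    have h2 : (∫⁻ s in Set.Ioo 0 T, E s) ≤ ENNReal.ofReal (E₀ / ν) := by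
      rw [← ENNReal.ofReal_toReal hfin, ENNReal.ofReal_le_ofReal_iff (div_nonneg hE₀ hν.le),
        le_div_iff₀ hν, mul_comm]
      exact hdiss
    exact h1.trans h2
  -- ### Step 2: for every `B > E₀/(ν τ)` some `s ∈ (t - τ, t)` has `E s ≤ B`
  have hgood : ∀ B : ℝ, E₀ / (ν * τ) < B → ∃ s ∈ Set.Ioo (t - τ) t, E s ≤ ENNReal.ofReal B := by
    intro B hB
    by_contra hne
    push Not at hne
    have hB0 : 0 < B := lt_of_le_of_lt (by positivity) hB
    -- then the window integral is at least `B τ > E₀/ν`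
    have hlow : ENNReal.ofReal B * volume (Set.Ioo (t - τ) t) ≤ ∫⁻ s in Set.Ioo (t - τ) t, E s := by
      rw [← setLIntegral_const]
      exact setLIntegral_mono' measurableSet_Ioo fun s hs => (hne s hs).le
    rw [Real.volume_Ioo, show t - (t - τ) = τ by ring, ← ENNReal.ofReal_mul hB0.le] at hlow
    have hlt : ENNReal.ofReal (E₀ / ν) < ENNReal.ofReal (B * τ) := by
      rw [ENNReal.ofReal_lt_ofReal_iff (mul_pos hB0 hτ)]
      rw [div_lt_iff₀ (mul_pos hν hτ)] at hB
      rw [div_lt_iff₀ hν]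
      linarith [mul_comm B (ν * τ), mul_assoc B ν τ]
    exact absurd ((hlow.trans hwin).trans_lt hlt) (lt_irrefl _)
  -- ### Step 3: Serrin's endpoint enstrophy inequality from such an `s` to `t`
  have hstep : ∀ B : ℝ, E₀ / (ν * τ) < B → E t ≤ ENNReal.ofReal (Real.exp (1 / 2) * B) := by
    intro B hB
    have hB0 : 0 < B := lt_of_le_of_lt (by positivity) hB
    obtain ⟨s, hs, hEs⟩ := hgood B hB
    have hs0 : 0 ≤ s := by linarith [hs.1]
    have hst : 0 < t - s := sub_pos.2 hs.2
    -- the representation on `[0, (t + T)/2]`, restarted at `s`, restricted to `[0, t - s]`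
    obtain ⟨P, hP⟩ := hrep ((t + T) / 2) ⟨by linarith [ht.1, ht.2], by linarith [ht.2]⟩
    have h2 : IsTaoSolutionOn (t - s) ν (u s) (fun r => u (r + s)) (fun r => P (r + s)) :=
      (hP.translate hs0 (by linarith [ht.2])).mono hst (by linarith [ht.2])
    have hbd : ∀ r ∈ Set.Icc 0 (t - s), ∀ x, ‖u (r + s) x‖ ≤ M := fun r hr x =>
      hdom (r + s) ⟨by linarith [hr.1], by linarith [hr.2]⟩ x
    have hmem : t - s ∈ Set.Ioc 0 (t - s) := ⟨hst, le_rfl⟩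
    have hgr := lintegral_frobeniusNormSq_fderiv_le_mul_exp hν hst h2.classical h2.sobolev
      h2.sobolev_dt h2.sobolev_p hM hmem hbd
    simp only [sub_add_cancel, zero_add] at hgr
    -- the exponent is at most `1/2`
    have hexp : Real.exp (M ^ 2 * (t - s) / (2 * ν)) ≤ Real.exp (1 / 2) := by
      refine Real.exp_le_exp.2 ?_
      have h1 : t - s ≤ τ := by linarith [hs.1]
      have h2' : M ^ 2 * (t - s) ≤ M ^ 2 * τ := mul_le_mul_of_nonneg_left h1 (pow_pos hM 2).le
      have h3 : M ^ 2 * τ = ν := by rw [hτ_def]; field_simp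
      rw [div_le_iff₀ (by positivity : (0 : ℝ) < 2 * ν)]
      linarith
    calc E t ≤ ENNReal.ofReal (Real.exp (M ^ 2 * (t - s) / (2 * ν))) * E s := hgr
      _ ≤ ENNReal.ofReal (Real.exp (1 / 2)) * ENNReal.ofReal B :=
          mul_le_mul' (ENNReal.ofReal_le_ofReal hexp) hEs
      _ = ENNReal.ofReal (Real.exp (1 / 2) * B) := (ENNReal.ofReal_mul (Real.exp_pos _).le).symm
  -- ### Step 4: let `B ↓ E₀/(ν τ) = E₀ M²/ν²`
  have hkey : E₀ / (ν * τ) = E₀ * M ^ 2 / ν ^ 2 := by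
    rw [hτ_def]
    field_simp
  have hgoal : Real.exp (1 / 2) * VectorCalculus.kineticEnergy (u 0) * M ^ 2 / ν ^ 2 =
      Real.exp (1 / 2) * (E₀ / (ν * τ)) := by
    rw [hkey, hE₀_def]
    ring
  rw [hgoal]
  refine ENNReal.le_of_forall_pos_le_add fun ε hε _ => ?_
  have hepos : 0 < Real.exp (1 / 2) := Real.exp_pos _
  have hεpos : (0 : ℝ) < ε := by exact_mod_cast hε
  have hB : E₀ / (ν * τ) < E₀ / (ν * τ) + ε / Real.exp (1 / 2) := by
    have : (0 : ℝ) < ε / Real.exp (1 / 2) := div_pos hεpos hepos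
    linarith
  calc E t ≤ ENNReal.ofReal (Real.exp (1 / 2) * (E₀ / (ν * τ) + ε / Real.exp (1 / 2))) := hstep _ hB
    _ = ENNReal.ofReal (Real.exp (1 / 2) * (E₀ / (ν * τ)) + ε) := by
        rw [mul_add, mul_div_cancel₀ _ hepos.ne']
    _ = ENNReal.ofReal (Real.exp (1 / 2) * (E₀ / (ν * τ))) + ε := by
        rw [ENNReal.ofReal_add (by positivity) hεpos.le, ENNReal.ofReal_coe_nnreal]

end Summit.NavierStokesRegularity.NavierStokesRegularity.Theorems.RecordZoomAncient.Birth

end
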